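import Summits.Ventures.GridStability.Lyapunov.WSCC9LossySplitLinesDual
import Literature.MathematicalPhysics.PowerSystems.LuriePostnikovSlabPositivity
import HarnessLib

/-!
# «SPLITU-LPCERT» — an exact Lur'e–Postnikov POSITIVITY certificate on the UNORDERED-LINES split
# presentation of the lossy 9-bus at `2·arctan(37/500)` (≈ 8.464°): the positivity lever MOVES the window

**CONSTRUCTION + THEOREM row beside #122 («SPLITU-8°»), #127 («SPLITU-CEILING») and «SPLITU-LPCEIL».**  On the
SAME typed object `S = WSCC9.splitLurieLinesSystem` (MODEL M′ = `WSCC9.postB_SPdamp.toModel`, Pai's split presentation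
(3.43), `Models/WSCC9SplitLurieLines.lean`; `A = AQ`, `C = CQ`, `B = BLQ` by `WSCC9LossySplitLines.A_eq/C_eq/B_eq`):

* `lpCert : LPSlabCertificate WSCC9.splitLurieLinesSystem` — an EXACT rational certificate of lit-6's WIDER class
  (`LuriePostnikovSlabPositivity.lean`: coercivity `P + Cᵀ·diag(λa)·C ⪰ ε·1` with `P` FREE) at the window
  `γ = 2·arctan(37/500)`: `P` dyadic `2⁻²⁴` and INDEFINITE (`P_σσ_neg`: a negative diagonal entry, so this
  is NOT a certificate of the class of record), `ε = 1/1048576`, `η = 1/524288`, `τ, λ ≥ 0` dyadic (`λ > 0` only on the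
  three sine line channels), OUTER dyadic sector slopes `a ≤ cos(|δ*| + γ)`, `b ≥ cos(|δ*| − γ)` (`2⁻²⁴`);
  BOTH matrix facts decided in the kernel over `ℚ` by lit-6's `LDLCert` DIRECTLY ON THE BLOCK FORMULAS
  (`lowerL_ldl` 5 × 5, `slabL_ldl` 23 × 23 with the six null rows) and cast to the typed object
  (`lower_eq`, `neg_slabMatrix_eq`);
* `hsecL` — the sector hypothesis of lit-6's LP ROA theorem on `|ξ − δ*_k| ≤ 2·arctan(37/500)`, all 18 channels
  (lyap-2's `sector_sin/cos_of_values` on the tree's exact `cd/sd`, kernel tests `sine_testsL`/`cosine_testsL`);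
* `lpSplitClass_nonempty` — HENCE the positivity class is NON-EMPTY at `2·arctan(37/500)` ≈ 8.464°;
* `positivityLever_split` — ONE kernel object: at `2·arctan(37/500)` the split class OF RECORD
  (`SlabCertificate WSCC9.splitLurieLinesSystem` + hsec) is EMPTY (#127 `WSCC9LossySplitLinesDual.splitSlabClass_empty`,
  from 8.122° on) while the split POSITIVITY class is NON-EMPTY — the positivity lever MOVES the window
  ceiling on this presentation (on the directed-polar form it did not: «#74-LP» / #118);
* `γ71_lt_γL`, `cos_sin_γL` — the windows in closed form; the positivity-class BRACKET (EMPTY from `2·arctan(3/40)`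
  ≈ 8.578° by the LP dual witness) is stated in `WSCC9LossySplitLinesLPDual.lean`, which imports this file.

PRODUCER (not trusted; everything re-decided here): lit-6 g9 kit j289752 (`lit/lit-6-probes/splitdual/primal_lp_splitu.py`,
output sha16 `d6706ac0dee25d88`): max-margin SDP (CLARABEL; `lower ⪰ ν·1`, `−𝓛 ⪰ ν·1` on the active block, `tr lower = 1`;
`ν* ≈ 7.45e-06`), dyadic rounding `2^-24`, exact `Fraction` re-check (`lower − ε·1` min pivot
`1.53e-04`, `−𝓛` active min pivot `1.95e-05`).  THREE COLUMNS.  CERTIFIED: the class statements above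
(about CERTIFICATE CLASSES on M′, not about the true region of attraction; an ROA sentence for `lpCert`
follows from `LPSlabCertificate.well_subset_regionOfAttraction` once the Lur'e-state derivative is wired as in
`WSCC9.lossy_splitLines_roa` — not done here).  VALIDATED (floats, kit j289677/j289752): positivity-class primal
margin `ν*` > 0 at `71/1000, 9/125, 73/1000, 37/500` and < 0 at `3/40`; exact positivity certificates also round
at `9/125` and `73/1000`.  MODELLED: as #122.
[cite: Khalil2002, §7.1 Example 7.5, §7.1.2 Theorem 7.3; Pai1981, §2.16 (2.63)–(2.64), §3.6.3 (3.43)–(3.45), §4.6 p. 117; BoydVandenberghe2004, §5.9.4]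
-/

noncomputable section

open Real Matrix
open Literature.Computation.Certificates
open Literature.MathematicalPhysics.PowerSystems
open Literature.MathematicalPhysics.PowerSystems.LyapunovFunctionFamily
open Summit.Ventures.GridStability.Models
open Summit.Ventures.GridStability.Lyapunov.WSCC9LossySplitSlab (e1 eκ e2 AQ CQ)
open Summit.Ventures.GridStability.Lyapunov.WSCC9LossySplitLines (BLQ A_eq C_eq B_eq)
open Summit.Ventures.GridStability.Bench.WSCC9LossySplitSlab (sector_sin_of_values sector_cos_of_values
  abs_angle_sub_lt)

namespace Summit.Ventures.GridStability.Lyapunov.WSCC9LossySplitLinesLPCert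

/-! ### The certificate literals (flattened indices: states `Fin 5` = `ω₀ ω₁ ω₂ σ₁ σ₂`; channels `Fin 18`,
sine `(p,q) ↦ 3p+q`, cosine `↦ 9+3p+q`) -/

/-- The quadratic part `P` (dyadic `2⁻²⁴`; INDEFINITE: the `σ`-diagonal entries are negative). -/
def Plq : Matrix (Fin 5) (Fin 5) ℚ :=
  !![156829/16777216, (-54515/8388608), (-45899/16777216), (-4909/16777216), 2463/8388608;
    (-54515/8388608), 61713/8388608, (-6915/8388608), 8097/8388608, (-757/4194304);
    (-45899/16777216), (-6915/8388608), 29987/8388608, (-237/2097152), 8431/16777216;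
    (-4909/16777216), 8097/8388608, (-237/2097152), (-15635/2097152), 10515/8388608;
    2463/8388608, (-757/4194304), 8431/16777216, 10515/8388608, (-255587/16777216)]

/-- Coercivity constant `ε = 1/1048576` of `P + Cᵀ·diag(λa)·C ⪰ ε·1`. -/
def epsLQ : ℚ := 1/1048576

/-- Decay rate `η = 1/524288`. -/
def etaLQ : ℚ := 1/524288

/-- S-procedure multipliers `τ_k ≥ 0` (zero on the six null channels). -/
def tauLQ : Fin 18 → ℚ :=
  ![0, 8993/32768, 8123579/16777216, 583/8388608, 0, 97483443/16777216, 31/262144, 419/2097152, 0, 0, 10688235/8388608, 44135065/16777216, 401/8388608, 0, 37383177/8388608, 63/2097152, 343/16777216, 0]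

/-- Popov coefficients `λ_k ≥ 0` (positive on the three sine line channels only). -/
def lamLQ : Fin 18 → ℚ :=
  ![0, 1808969/8388608, 2390713/8388608, 0, 0, 2810941/8388608, 0, 0, 0, 0, 0, 0, 0, 0, 0, 0, 0, 0]

/-- OUTER lower slopes `a_k ≤ cos(|δ*_k| + γ)` (dyadic `2⁻²⁴`; `−1` on the null channels). -/
def aLQ : Fin 18 → ℚ :=
  ![(-1), 11365801/16777216, 14106891/16777216, 11365801/16777216, (-1), 15438031/16777216, 14106891/16777216, 15438031/16777216, (-1), (-1), 8496467/16777216, 4580155/16777216, (-12340727/16777216), (-1), (-6568269/16777216), (-9081333/16777216), 55887/524288, (-1)]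

/-- OUTER upper slopes `b_k ≥ cos(|δ*_k| − γ)` (dyadic `2⁻²⁴`; `1` on the null channels). -/
def bLQ : Fin 18 → ℚ :=
  ![1, 14466687/16777216, 16139925/16777216, 14466687/16777216, 1, 16681627/16777216, 16139925/16777216, 16681627/16777216, 1, 1, 12340727/16777216, 9081333/16777216, (-8496467/16777216), 1, (-55887/524288), (-4580155/16777216), 6568269/16777216, 1]

/-- `P` on the typed state index. -/
def PL : Matrix (Fin 3 ⊕ Fin 2) (Fin 3 ⊕ Fin 2) ℚ := Plq.submatrix e1 e1
/-- `τ` on the typed channel index. -/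
def tauL (k : (Fin 3 × Fin 3) ⊕ (Fin 3 × Fin 3)) : ℚ := tauLQ (eκ k)
/-- `λ` on the typed channel index. -/
def lamL (k : (Fin 3 × Fin 3) ⊕ (Fin 3 × Fin 3)) : ℚ := lamLQ (eκ k)
/-- `a` on the typed channel index. -/
def aL (k : (Fin 3 × Fin 3) ⊕ (Fin 3 × Fin 3)) : ℚ := aLQ (eκ k)
/-- `b` on the typed channel index. -/
def bL (k : (Fin 3 × Fin 3) ⊕ (Fin 3 × Fin 3)) : ℚ := bLQ (eκ k)

/-! ### Scalar tests and the two matrix facts, decided over `ℚ` -/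

/-- `0 < ε`, `0 < η`. -/
theorem epsL_etaL_pos : 0 < epsLQ ∧ 0 < etaLQ := by
  constructor <;> norm_num [epsLQ, etaLQ]

/-- `τ_k ≥ 0`, `λ_k ≥ 0` on every channel (kernel). -/
theorem multL_nonneg : ∀ k, 0 ≤ tauLQ k ∧ 0 ≤ lamLQ k := by
  decide +kernel

/-- `P` is symmetric (kernel). -/
theorem PL_transpose : PLᵀ = PL := by
  decide +kernel

/-- **`P` is indefinite**: the diagonal entry at `σ₁` is negative — `lpCert` is NOT a certificate of the class
of record (`SlabCertificate` needs `P ⪰ ε·1`). -/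
theorem P_σσ_neg : PL (Sum.inr 0) (Sum.inr 0) < 0 := by
  decide +kernel

/-- The lower comparison matrix `P + Cᵀ·diag(λ_k a_k)·C − ε·1` over `ℚ`. -/
def lowerLQ : Matrix (Fin 3 ⊕ Fin 2) (Fin 3 ⊕ Fin 2) ℚ :=
  PL + CQᵀ * Matrix.diagonal (fun k => lamL k * aL k) * CQ - epsLQ • (1 : Matrix (Fin 3 ⊕ Fin 2) (Fin 3 ⊕ Fin 2) ℚ)

/-- State block of `𝓛` over `ℚ`: `AᵀP + PA + η·1 − Cᵀ·diag(τab)·C`. -/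
def LL11Q : Matrix (Fin 3 ⊕ Fin 2) (Fin 3 ⊕ Fin 2) ℚ :=
  AQᵀ * PL + PL * AQ + etaLQ • (1 : Matrix (Fin 3 ⊕ Fin 2) (Fin 3 ⊕ Fin 2) ℚ)
    - CQᵀ * Matrix.diagonal (fun k => tauL k * (aL k * bL k)) * CQ

/-- Cross block of `𝓛` over `ℚ`: `−PB + (CA)ᵀ·diag(λ) + Cᵀ·diag(τ(a+b)/2)`. -/
def LL12Q : Matrix (Fin 3 ⊕ Fin 2) ((Fin 3 × Fin 3) ⊕ (Fin 3 × Fin 3)) ℚ :=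
  -(PL * BLQ) + (CQ * AQ)ᵀ * Matrix.diagonal lamL + CQᵀ * Matrix.diagonal (fun k => tauL k * (aL k + bL k) / 2)

/-- Channel block of `𝓛` over `ℚ`: `−diag(λ)·CB − (diag(λ)·CB)ᵀ − diag τ`. -/
def LL22Q : Matrix ((Fin 3 × Fin 3) ⊕ (Fin 3 × Fin 3)) ((Fin 3 × Fin 3) ⊕ (Fin 3 × Fin 3)) ℚ :=
  -(Matrix.diagonal lamL * (CQ * BLQ)) - (Matrix.diagonal lamL * (CQ * BLQ))ᵀ - Matrix.diagonal tauL

set_option maxHeartbeats 4000000 in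
/-- **`P + Cᵀ·diag(λa)·C − ε·1 ⪰ 0`** (5 × 5), decided in the kernel on the formula. -/
theorem lowerL_ldl : PSD.LDLCert (lowerLQ.submatrix e1.symm e1.symm) := by
  decide +kernel

set_option maxHeartbeats 8000000 in
/-- **`−𝓛 ⪰ 0`** (23 × 23 with six null rows), decided in the kernel DIRECTLY on lit-6's block formulas. -/
theorem slabL_ldl :
    PSD.LDLCert ((-(Matrix.fromBlocks LL11Q LL12Q LL12Qᵀ LL22Q)).submatrix e2.symm e2.symm) := by
  decide +kernel

/-! ### The certificate data over `ℝ` and the cast identities -/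

/-- `P` (real). -/
def Pr : Matrix (Fin 3 ⊕ Fin 2) (Fin 3 ⊕ Fin 2) ℝ := PL.map (Rat.cast : ℚ → ℝ)
/-- `τ` (real). -/
def τr : (Fin 3 × Fin 3) ⊕ (Fin 3 × Fin 3) → ℝ := fun k => (tauL k : ℝ)
/-- `λ` (real). -/
def lamr : (Fin 3 × Fin 3) ⊕ (Fin 3 × Fin 3) → ℝ := fun k => (lamL k : ℝ)
/-- `a` (real). -/
def ar : (Fin 3 × Fin 3) ⊕ (Fin 3 × Fin 3) → ℝ := fun k => (aL k : ℝ)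
/-- `b` (real). -/
def br : (Fin 3 × Fin 3) ⊕ (Fin 3 × Fin 3) → ℝ := fun k => (bL k : ℝ)

/-- `(M·N) ↦ ℝ` (plumbing). -/
private theorem map_mul' {m n o : Type*} [Fintype n] (M : Matrix m n ℚ) (N : Matrix n o ℚ) :
    (M * N).map (Rat.cast : ℚ → ℝ) = M.map (Rat.cast : ℚ → ℝ) * N.map (Rat.cast : ℚ → ℝ) :=
  Matrix.map_mul (f := Rat.castHom ℝ)
/-- `(M + N) ↦ ℝ` (plumbing). -/
private theorem map_add' {m n : Type*} (M N : Matrix m n ℚ) :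
    (M + N).map (Rat.cast : ℚ → ℝ) = M.map (Rat.cast : ℚ → ℝ) + N.map (Rat.cast : ℚ → ℝ) := by
  ext; simp
/-- `(M − N) ↦ ℝ` (plumbing). -/
private theorem map_sub' {m n : Type*} (M N : Matrix m n ℚ) :
    (M - N).map (Rat.cast : ℚ → ℝ) = M.map (Rat.cast : ℚ → ℝ) - N.map (Rat.cast : ℚ → ℝ) := by
  ext; simp
/-- `(−M) ↦ ℝ` (plumbing). -/
private theorem map_neg' {m n : Type*} (M : Matrix m n ℚ) :
    (-M).map (Rat.cast : ℚ → ℝ) = -M.map (Rat.cast : ℚ → ℝ) := by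
  ext; simp
/-- `Mᵀ ↦ ℝ` (plumbing). -/
private theorem map_transpose' {m n : Type*} (M : Matrix m n ℚ) :
    Mᵀ.map (Rat.cast : ℚ → ℝ) = (M.map (Rat.cast : ℚ → ℝ))ᵀ := by
  ext; simp
/-- `diagonal d ↦ ℝ` (plumbing). -/
private theorem map_diagonal' {n : Type*} [DecidableEq n] (d : n → ℚ) :
    (Matrix.diagonal d).map (Rat.cast : ℚ → ℝ) = Matrix.diagonal (fun i => ((d i : ℚ) : ℝ)) :=
  Matrix.diagonal_map (Rat.cast_zero)
/-- `q • 1 ↦ ℝ` (plumbing). -/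
private theorem map_smul_one' {n : Type*} [DecidableEq n] (q : ℚ) :
    (q • (1 : Matrix n n ℚ)).map (Rat.cast : ℚ → ℝ) = ((q : ℚ) : ℝ) • (1 : Matrix n n ℝ) := by
  ext i j; by_cases h : i = j <;> simp [h]

/-- State block identity. -/
private theorem L11_eq : slabL11 WSCC9.splitLurieLinesSystem Pr (etaLQ : ℝ) τr ar br = LL11Q.map (Rat.cast : ℚ → ℝ) := by
  have hd : Matrix.diagonal (fun k => τr k * (ar k * br k))
      = (Matrix.diagonal (fun k => tauL k * (aL k * bL k))).map (Rat.cast : ℚ → ℝ) := by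
    rw [map_diagonal']
    congr 1; funext k; simp [τr, ar, br]
  rw [slabL11, A_eq, C_eq, hd, Pr, LL11Q]
  simp only [map_sub', map_add', map_mul', map_transpose', map_smul_one']

/-- Cross block identity. -/
private theorem L12_eq : slabL12 WSCC9.splitLurieLinesSystem Pr lamr τr ar br = LL12Q.map (Rat.cast : ℚ → ℝ) := by
  have hd1 : Matrix.diagonal lamr = (Matrix.diagonal lamL).map (Rat.cast : ℚ → ℝ) := by
    rw [map_diagonal']; rfl
  have hd2 : Matrix.diagonal (fun k => τr k * (ar k + br k) / 2)
      = (Matrix.diagonal (fun k => tauL k * (aL k + bL k) / 2)).map (Rat.cast : ℚ → ℝ) := by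
    rw [map_diagonal']
    congr 1; funext k; simp [τr, ar, br]
  rw [slabL12, A_eq, B_eq, C_eq, hd1, hd2, Pr, LL12Q]
  simp only [map_add', map_neg', map_mul', map_transpose']

/-- Channel block identity. -/
private theorem L22_eq : slabL22 WSCC9.splitLurieLinesSystem lamr τr = LL22Q.map (Rat.cast : ℚ → ℝ) := by
  have hd1 : Matrix.diagonal lamr = (Matrix.diagonal lamL).map (Rat.cast : ℚ → ℝ) := by
    rw [map_diagonal']; rfl
  have hd3 : Matrix.diagonal τr = (Matrix.diagonal tauL).map (Rat.cast : ℚ → ℝ) := by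
    rw [map_diagonal']; rfl
  rw [slabL22, B_eq, C_eq, hd1, hd3, LL22Q]
  simp only [map_sub', map_neg', map_mul', map_transpose']

/-- **`−𝓛` over `ℝ` is the cast of the `ℚ` block matrix.** -/
theorem neg_slabMatrix_eq : -(slabMatrix WSCC9.splitLurieLinesSystem Pr (etaLQ : ℝ) lamr τr ar br)
    = (-(Matrix.fromBlocks LL11Q LL12Q LL12Qᵀ LL22Q)).map (Rat.cast : ℚ → ℝ) := by
  rw [slabMatrix, L11_eq, L12_eq, L22_eq, ← map_transpose', ← Matrix.fromBlocks_map, ← map_neg']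

/-- **The lower comparison matrix over `ℝ` is the cast of `lowerLQ`.** -/
theorem lower_eq : Pr + WSCC9.splitLurieLinesSystem.Cᵀ * Matrix.diagonal (fun k => lamr k * ar k) * WSCC9.splitLurieLinesSystem.C
      - (epsLQ : ℝ) • (1 : Matrix (Fin 3 ⊕ Fin 2) (Fin 3 ⊕ Fin 2) ℝ)
    = lowerLQ.map (Rat.cast : ℚ → ℝ) := by
  have hd : Matrix.diagonal (fun k => lamr k * ar k)
      = (Matrix.diagonal (fun k => lamL k * aL k)).map (Rat.cast : ℚ → ℝ) := by
    rw [map_diagonal']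
    congr 1; funext k; simp [lamr, ar]
  rw [C_eq, hd, Pr, lowerLQ]
  simp only [map_sub', map_add', map_mul', map_transpose', map_smul_one']

/-- `lowerLQ ⪰ 0` over `ℝ` (from the kernel `LDLᵀ`, reindexed back). -/
private theorem lower_psd : (lowerLQ.map (Rat.cast : ℚ → ℝ)).PosSemidef := by
  have h := (lowerL_ldl.posSemidef (R := ℝ)).submatrix e1
  have e : ((lowerLQ.submatrix ⇑e1.symm ⇑e1.symm).map (Rat.cast : ℚ → ℝ)).submatrix e1 e1
      = lowerLQ.map (Rat.cast : ℚ → ℝ) := by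
    ext i j; simp
  rwa [e] at h

/-- `−(block matrix) ⪰ 0` over `ℝ` (from the kernel `LDLᵀ`, reindexed back). -/
private theorem slab_psd : ((-(Matrix.fromBlocks LL11Q LL12Q LL12Qᵀ LL22Q)).map (Rat.cast : ℚ → ℝ)).PosSemidef := by
  have h := (slabL_ldl.posSemidef (R := ℝ)).submatrix e2
  have e : (((-(Matrix.fromBlocks LL11Q LL12Q LL12Qᵀ LL22Q)).submatrix ⇑e2.symm ⇑e2.symm).map
      (Rat.cast : ℚ → ℝ)).submatrix e2 e2
      = (-(Matrix.fromBlocks LL11Q LL12Q LL12Qᵀ LL22Q)).map (Rat.cast : ℚ → ℝ) := by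
    ext i j; simp
  rwa [e] at h

/-! ### The certificate -/

/-- **An exact Lur'e–Postnikov POSITIVITY certificate on the unordered-lines split presentation at
`2·arctan(37/500)`** (lit-6's `LPSlabCertificate`; `P` indefinite, `P + Cᵀ·diag(λa)·C ≻ ε·1`).
[cite: Khalil2002, §7.1.2 Theorem 7.3 with §7.1 Example 7.5; Pai1981, §2.16 (2.63)–(2.64), §3.6.3 (3.43)–(3.45)] -/
def lpCert : LPSlabCertificate WSCC9.splitLurieLinesSystem where
  P := Pr
  ε := (epsLQ : ℝ)
  η := (etaLQ : ℝ)
  τ := τr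
  lam := lamr
  a := ar
  b := br
  P_symm := by
    show (PL.map (Rat.cast : ℚ → ℝ))ᵀ = PL.map (Rat.cast : ℚ → ℝ)
    rw [← map_transpose', PL_transpose]
  ε_pos := by exact_mod_cast epsL_etaL_pos.1
  η_pos := by exact_mod_cast epsL_etaL_pos.2
  lower_ge := by rw [lower_eq]; exact lower_psd
  τ_nonneg := fun k => by unfold τr tauL; exact_mod_cast (multL_nonneg (eκ k)).1
  lam_nonneg := fun k => by unfold lamr lamL; exact_mod_cast (multL_nonneg (eκ k)).2
  lmi := by rw [neg_slabMatrix_eq]; exact slab_psd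

/-- The certificate's slopes are the literals (definitional). -/
theorem lpCert_a_b (k : (Fin 3 × Fin 3) ⊕ (Fin 3 × Fin 3)) :
    lpCert.a k = ((aLQ (eκ k) : ℚ) : ℝ) ∧ lpCert.b k = ((bLQ (eκ k) : ℚ) : ℝ) := ⟨rfl, rfl⟩

/-- **`lpCert.P` has a negative diagonal entry** (so `lpCert.P` is not positive semidefinite: the certificate
lies outside the class of record). -/
theorem lpCert_P_σσ_neg : lpCert.P (Sum.inr 0) (Sum.inr 0) < 0 := by
  show ((PL (Sum.inr 0) (Sum.inr 0) : ℚ) : ℝ) < 0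
  exact_mod_cast P_σσ_neg

/-! ### The sector hypothesis at `γ = 2·arctan(37/500)` -/

/-- `cos γ = 248631/251369` and `sin γ = 37000/251369` for `γ = 2·arctan(37/500)`. -/
theorem cos_sin_γL : Real.cos (2 * Real.arctan (37 / 500 : ℝ)) = ((248631/251369 : ℚ) : ℝ) ∧
    Real.sin (2 * Real.arctan (37 / 500 : ℝ)) = ((37000/251369 : ℚ) : ℝ) := by
  rw [Lyapunov.StructurePreserving.cos_two_mul_arctan, Lyapunov.StructurePreserving.sin_two_mul_arctan]
  constructor <;> push_cast <;> norm_num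

/-- `0 ≤ γ < π/2`. -/
theorem γL_range : 0 ≤ 2 * Real.arctan (37 / 500 : ℝ) ∧ 2 * Real.arctan (37 / 500 : ℝ) < π / 2 :=
  ⟨Lyapunov.StructurePreserving.two_mul_arctan_nonneg (by norm_num),
    Lyapunov.StructurePreserving.two_mul_arctan_lt_pi_div_two (by norm_num)⟩

/-- Null (diagonal) channels carry the trivial sector `[−1, 1]` (kernel). -/
theorem null_slopesL : ∀ p : Fin 3,
    aLQ (eκ (Sum.inl (p, p))) = -1 ∧ bLQ (eκ (Sum.inl (p, p))) = 1 ∧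
      aLQ (eκ (Sum.inr (p, p))) = -1 ∧ bLQ (eκ (Sum.inr (p, p))) = 1 := by
  decide +kernel

set_option maxHeartbeats 4000000 in
/-- **Sine-family tests at `(cos γ, sin γ) = (248631, 37000)/251369`** for every ordered pair `p ≠ q`:
`sin γ ≤ |sd|`, `a ≤ cd·cos γ − |sd|·sin γ`, `cd·cos γ + |sd|·sin γ ≤ b` (kernel, outer dyadic slopes). -/
theorem sine_testsL : ∀ p q : Fin 3, p ≠ q →
    (37000/251369 : ℚ) ≤ |WSCC9.postB_SPdamp.sd p q| ∧
      aLQ (eκ (Sum.inl (p, q))) ≤ WSCC9.postB_SPdamp.cd p q * (248631/251369) - |WSCC9.postB_SPdamp.sd p q| * (37000/251369) ∧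
      WSCC9.postB_SPdamp.cd p q * (248631/251369) + |WSCC9.postB_SPdamp.sd p q| * (37000/251369) ≤ bLQ (eκ (Sum.inl (p, q))) := by
  decide +kernel

set_option maxHeartbeats 4000000 in
/-- **Cosine-family tests** for every ordered pair `p ≠ q`: `sin γ ≤ cd`, `a ≤ −(sd·cos γ + cd·sin γ)`,
`−(sd·cos γ − cd·sin γ) ≤ b` (kernel). -/
theorem cosine_testsL : ∀ p q : Fin 3, p ≠ q →
    (37000/251369 : ℚ) ≤ WSCC9.postB_SPdamp.cd p q ∧
      aLQ (eκ (Sum.inr (p, q))) ≤ -(WSCC9.postB_SPdamp.sd p q * (248631/251369) + WSCC9.postB_SPdamp.cd p q * (37000/251369)) ∧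
      -(WSCC9.postB_SPdamp.sd p q * (248631/251369) - WSCC9.postB_SPdamp.cd p q * (37000/251369)) ≤ bLQ (eκ (Sum.inr (p, q))) := by
  decide +kernel

/-- **`hsecL`**: on the window `|ξ − δ*_k| ≤ 2·arctan(37/500)` every channel's cosine lies in `[a_k, b_k]`. -/
theorem hsecL : ∀ k ξ, |ξ - WSCC9.splitLurieLinesSystem.δs k| ≤ 2 * Real.arctan (37 / 500 : ℝ) →
    lpCert.a k ≤ Real.cos ξ ∧ Real.cos ξ ≤ lpCert.b k := by
  rintro (⟨p, q⟩ | ⟨p, q⟩) ξ hξ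
  · rw [(lpCert_a_b _).1, (lpCert_a_b _).2]
    change |ξ - (WSCC9.postB_SPdamp.angleOf p - WSCC9.postB_SPdamp.angleOf q)| ≤ _ at hξ
    by_cases hpq : p = q
    · subst hpq
      obtain ⟨h1, h2, -, -⟩ := null_slopesL p
      rw [h1, h2]; push_cast
      exact ⟨Real.neg_one_le_cos ξ, Real.cos_le_one ξ⟩
    · obtain ⟨t1, t2, t3⟩ := sine_testsL p q hpq
      refine sector_sin_of_values (abs_angle_sub_lt p q) γL_range.1 γL_range.2 (WSCC9.sin_angleOf_sub p q)
        (WSCC9.cos_angleOf_sub p q) cos_sin_γL.1 cos_sin_γL.2 ?_ ?_ ?_ ξ hξ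
      · rw [← Rat.cast_abs]; exact_mod_cast t1
      · rw [← Rat.cast_abs]; exact_mod_cast t2
      · rw [← Rat.cast_abs]; exact_mod_cast t3
  · rw [(lpCert_a_b _).1, (lpCert_a_b _).2]
    change |ξ - (WSCC9.postB_SPdamp.angleOf p - WSCC9.postB_SPdamp.angleOf q + π / 2)| ≤ _ at hξ
    by_cases hpq : p = q
    · subst hpq
      obtain ⟨-, -, h1, h2⟩ := null_slopesL p
      rw [h1, h2]; push_cast
      exact ⟨Real.neg_one_le_cos ξ, Real.cos_le_one ξ⟩
    · obtain ⟨t1, t2, t3⟩ := cosine_testsL p q hpq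
      refine sector_cos_of_values (abs_angle_sub_lt p q) γL_range.2.le (WSCC9.sin_angleOf_sub p q)
        (WSCC9.cos_angleOf_sub p q) cos_sin_γL.1 cos_sin_γL.2 ?_ ?_ ?_ ξ hξ
      · exact_mod_cast t1
      · exact_mod_cast t2
      · exact_mod_cast t3

/-! ### THE THEOREMS -/

/-- **The positivity class is NON-EMPTY at `2·arctan(37/500)`** (≈ 8.464°). -/
theorem lpSplitClass_nonempty :
    ∃ Λ : LPSlabCertificate WSCC9.splitLurieLinesSystem,
      ∀ k ξ, |ξ - WSCC9.splitLurieLinesSystem.δs k| ≤ 2 * Real.arctan (37 / 500 : ℝ) → Λ.a k ≤ Real.cos ξ ∧ Real.cos ξ ≤ Λ.b k :=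
  ⟨lpCert, hsecL⟩

/-- #127's threshold lies below this window: `2·arctan(71/1000) < 2·arctan(37/500)`. -/
theorem γ71_lt_γL : WSCC9LossySplitLinesDual.γ₀ < 2 * Real.arctan (37 / 500 : ℝ) := by
  unfold WSCC9LossySplitLinesDual.γ₀
  have h : ((WSCC9LossySplitLinesDual.u0Q : ℚ) : ℝ) < 37 / 500 := by
    norm_num [WSCC9LossySplitLinesDual.u0Q]
  have := Real.arctan_strictMono h
  linarith

/-- **THE POSITIVITY LEVER MOVES THE SPLIT WINDOW** (one kernel object): at the window `2·arctan(37/500)`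
(≈ 8.464°) on `S = WSCC9.splitLurieLinesSystem` the slab/Popov class OF RECORD (`SlabCertificate` + hsec) is EMPTY
(#127, from `2·arctan(71/1000)` ≈ 8.122° on) while the Lur'e–Postnikov POSITIVITY class (`LPSlabCertificate` +
hsec) is NON-EMPTY (`lpCert`).  Contrast: on the directed-polar presentation both classes are empty from
7.666° and non-empty at 7.438° («#74-LP» `WSCC9LossySlabLPDual.lpClassCeiling_bracket`). -/
theorem positivityLever_split :
    (¬ ∃ Λ : SlabCertificate WSCC9.splitLurieLinesSystem,
      ∀ k ξ, |ξ - WSCC9.splitLurieLinesSystem.δs k| ≤ 2 * Real.arctan (37 / 500 : ℝ) → Λ.a k ≤ Real.cos ξ ∧ Real.cos ξ ≤ Λ.b k) ∧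
    ∃ Λ : LPSlabCertificate WSCC9.splitLurieLinesSystem,
      ∀ k ξ, |ξ - WSCC9.splitLurieLinesSystem.δs k| ≤ 2 * Real.arctan (37 / 500 : ℝ) → Λ.a k ≤ Real.cos ξ ∧ Real.cos ξ ≤ Λ.b k :=
  ⟨WSCC9LossySplitLinesDual.splitSlabClass_empty _ γ71_lt_γL.le, lpSplitClass_nonempty⟩

end Summit.Ventures.GridStability.Lyapunov.WSCC9LossySplitLinesLPCert

end

-- rebuild trigger (content-neutral revision, hub single-module build starvation 2026-08-27T21:4xZ; lead g8 RULING 9bm (1)(a) precedent)
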